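import Mathlib.LinearAlgebra.Matrix.NonsingularInverse
import Mathlib.LinearAlgebra.Matrix.Rank
import Mathlib.LinearAlgebra.FiniteDimensional.Lemmas
import HarnessLib

/-!
# The generalized cross product of the rows of a `d × (d + 1)` matrix

Topic `Literature/LinearAlgebra/Matrix`. For a `d × (d + 1)` matrix `A` over a commutative ring,
the vector `cross A ∈ R^{d+1}` of signed maximal minors,
`(cross A)ⱼ = (-1)^{d+j} det (A with column j deleted)`, is characterised by the Laplace
expansion along the last row (folklore; e.g. M. Spivak, *Calculus on Manifolds* (1965), Ch. 4,
p. 84, "generalized cross product `v₁ × ⋯ × v_{n-1}`", and Milnor, *Topology from the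
Differentiable Viewpoint* (1965), §2, for its use as the tangent field of a regular level curve):

* `dotProduct_cross` : `α ⬝ cross A = det [A; α]` for every row vector `α` (the matrix `A` with
  `α` appended as last row, `snocRow A α`);
* `mulVec_cross` : `A · cross A = 0` (each row of `A` is orthogonal to `cross A`);
* `cross_ne_zero_iff` (over a field): `cross A ≠ 0` iff the rows of `A` are linearly independent;
* `ker_mulVecLin_eq_span_cross` (over a field, rows independent): the kernel of `A` is the line
  spanned by `cross A`.

This is the algebraic part of the tangent vector field `⋆(dH₁ ∧ ⋯ ∧ dH_d)` of the level curve of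
a submersion `H : ℝ^{d+1} → ℝ^d` used in Khovanskii's method (A. G. Khovanskii, *Fewnomials*
(1991), Ch. III).

Mathlib has the cross product only on `R³` (`crossProduct`, with which `cross` agrees for
`d = 2`) and Laplace expansion (`Matrix.det_succ_row`). **Relation to the tree:**
`Literature.AlgebraicGeometry.Motives.crossVec d r` (`Literature/AlgebraicGeometry/Motives/SeesawGrauert.lean`,
rows `r : Fin k → ι` of a matrix `d : Matrix ι (Fin (k+1)) R`) is the same vector with the same
sign: `crossVec d r = cross (d.submatrix r id)` holds by `rfl`. This file is intended as the
canonical, lightly-imported home of the notion (Laplace identity for an arbitrary appended row,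
kernel and independence statements over a field); `SeesawGrauert.lean` (one internal user) can be
redirected to it by a librarian item — it is deliberately not imported here (scheme-theoretic
imports). The unfolding lemma is called `cross_def` (not `cross_apply`, which would be ambiguous
with Mathlib's root `cross_apply` under `open Literature.LinearAlgebra.Matrix`).
-/

namespace Literature.LinearAlgebra.Matrix

open _root_.Matrix

variable {R : Type*} {d : ℕ}

/-- The square matrix `[A; α]` obtained from a `d × (d+1)` matrix `A` by appending the row `α`
as last row. [folklore] -/
def snocRow (A : Matrix (Fin d) (Fin (d + 1)) R) (α : Fin (d + 1) → R) :
    Matrix (Fin (d + 1)) (Fin (d + 1)) R :=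
  Matrix.of (Fin.snoc (fun i => A i) α : Fin (d + 1) → Fin (d + 1) → R)

/-- Rows of `[A; α]` with index `< d` are the rows of `A`. [folklore] -/
@[simp] theorem snocRow_castSucc (A : Matrix (Fin d) (Fin (d + 1)) R) (α : Fin (d + 1) → R)
    (i : Fin d) : snocRow A α (Fin.castSucc i) = A i := by
  funext j
  simp [snocRow]

/-- The last row of `[A; α]` is `α`. [folklore] -/
@[simp] theorem snocRow_last (A : Matrix (Fin d) (Fin (d + 1)) R) (α : Fin (d + 1) → R) :
    snocRow A α (Fin.last d) = α := by
  funext j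
  simp [snocRow]

variable [CommRing R]

/-- The **generalized cross product** of the rows of a `d × (d + 1)` matrix: the vector of signed
maximal minors `(cross A)ⱼ = (-1)^{d + j} · det (A with column j deleted)`. [folklore] -/
def cross (A : Matrix (Fin d) (Fin (d + 1)) R) : Fin (d + 1) → R :=
  fun j => (-1) ^ (d + (j : ℕ)) * (A.submatrix _root_.id j.succAbove).det

/-- Entries of the cross product (unfolding lemma). [folklore] -/
theorem cross_def (A : Matrix (Fin d) (Fin (d + 1)) R) (j : Fin (d + 1)) :
    cross A j = (-1) ^ (d + (j : ℕ)) * (A.submatrix _root_.id j.succAbove).det := rfl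

/-- **Laplace expansion along the appended row**: `α ⬝ cross A = det [A; α]`. [folklore] -/
theorem dotProduct_cross (A : Matrix (Fin d) (Fin (d + 1)) R) (α : Fin (d + 1) → R) :
    α ⬝ᵥ cross A = (snocRow A α).det := by
  rw [Matrix.det_succ_row (snocRow A α) (Fin.last d), dotProduct]
  refine Finset.sum_congr rfl fun j _ => ?_
  have hsub : (snocRow A α).submatrix (Fin.last d).succAbove j.succAbove =
      A.submatrix _root_.id j.succAbove := by
    ext i l
    simp [Matrix.submatrix_apply, Fin.succAbove_last]
  rw [hsub, snocRow_last, cross_def, Fin.val_last]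
  ring

/-- The same identity with the factors of the dot product swapped. [folklore] -/
theorem cross_dotProduct (A : Matrix (Fin d) (Fin (d + 1)) R) (α : Fin (d + 1) → R) :
    cross A ⬝ᵥ α = (snocRow A α).det := by
  rw [dotProduct_comm, dotProduct_cross]

/-- Each row of `A` is orthogonal to `cross A`: `A · cross A = 0`. [folklore] -/
theorem mulVec_cross (A : Matrix (Fin d) (Fin (d + 1)) R) : A *ᵥ cross A = 0 := by
  funext i
  rw [Matrix.mulVec, Pi.zero_apply, dotProduct_cross]
  refine Matrix.det_zero_of_row_eq (i := Fin.castSucc i) (j := Fin.last d)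
    (Fin.castSucc_lt_last i).ne ?_
  rw [snocRow_castSucc, snocRow_last]

/-- Row form of `mulVec_cross`: `∑ⱼ A i j · (cross A)ⱼ = 0`. [folklore] -/
theorem dotProduct_row_cross (A : Matrix (Fin d) (Fin (d + 1)) R) (i : Fin d) :
    A i ⬝ᵥ cross A = 0 := by
  have := congrFun (mulVec_cross A) i
  rwa [Matrix.mulVec, Pi.zero_apply] at this

section Field

variable {F : Type*} [Field F]

/-- If some entry of `cross A` is nonzero (a nonzero maximal minor), the rows of `A` are linearly
independent. [folklore] -/
theorem linearIndependent_rows_of_cross_ne_zero (A : Matrix (Fin d) (Fin (d + 1)) F)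
    (h : cross A ≠ 0) : LinearIndependent F (fun i => A i) := by
  obtain ⟨j, hj⟩ := Function.ne_iff.1 h
  rw [cross_def, Pi.zero_apply, mul_ne_zero_iff] at hj
  have hu : IsUnit (A.submatrix _root_.id j.succAbove) :=
    (Matrix.isUnit_iff_isUnit_det _).2 (isUnit_iff_ne_zero.2 hj.2)
  have hrows : LinearIndependent F (A.submatrix _root_.id j.succAbove).row :=
    Matrix.linearIndependent_rows_iff_isUnit.2 hu
  have e : (A.submatrix _root_.id j.succAbove).row =
      (LinearMap.funLeft F F j.succAbove) ∘ (fun i => A i) := by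
    funext i; rfl
  rw [e] at hrows
  exact hrows.of_comp _

/-- If the rows of `A` are linearly independent then `cross A ≠ 0`: some coordinate vector `eⱼ`
is not in the row span, so `[A; eⱼ]` is invertible and `(cross A)ⱼ = det [A; eⱼ] ≠ 0`.
[folklore] -/
theorem cross_ne_zero_of_linearIndependent_rows (A : Matrix (Fin d) (Fin (d + 1)) F)
    (h : LinearIndependent F (fun i => A i)) : cross A ≠ 0 := by
  -- some coordinate vector is outside the row span (the span has dimension `d < d + 1`)
  have hex : ∃ j : Fin (d + 1), Pi.single j (1 : F) ∉ Submodule.span F (Set.range fun i => A i) := by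
    by_contra hall
    push Not at hall
    have htop : (⊤ : Submodule F (Fin (d + 1) → F)) ≤ Submodule.span F (Set.range fun i => A i) := by
      rw [← (Pi.basisFun F (Fin (d + 1))).span_eq, Submodule.span_le]
      rintro _ ⟨j, rfl⟩
      simpa [Pi.basisFun_apply] using hall j
    have h1 : Module.finrank F (Fin (d + 1) → F) ≤
        Module.finrank F (Submodule.span F (Set.range fun i => A i)) := by
      rw [← finrank_top F (Fin (d + 1) → F)]
      exact Submodule.finrank_mono htop
    have h2 : Module.finrank F (Submodule.span F (Set.range fun i => A i)) = d := by
      rw [finrank_span_eq_card h, Fintype.card_fin]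
    rw [h2, Module.finrank_fin_fun] at h1
    omega
  obtain ⟨j, hj⟩ := hex
  -- then `[A; eⱼ]` has independent rows, hence nonzero determinant
  have hli : LinearIndependent F (fun i => snocRow A (Pi.single j 1) i) := by
    have e : (fun i => snocRow A (Pi.single j (1 : F)) i) =
        Fin.snoc (fun i => A i) (Pi.single j (1 : F)) := by
      funext i
      refine Fin.lastCases ?_ (fun i => ?_) i
      · simp
      · simp
    rw [e, linearIndependent_finSnoc]
    exact ⟨h, hj⟩
  have hdet : (snocRow A (Pi.single j 1)).det ≠ 0 := by
    have hu : IsUnit (snocRow A (Pi.single j (1 : F))) :=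
      Matrix.linearIndependent_rows_iff_isUnit.1 hli
    exact isUnit_iff_ne_zero.1 ((Matrix.isUnit_iff_isUnit_det _).1 hu)
  intro hzero
  apply hdet
  rw [← dotProduct_cross, hzero, dotProduct_zero]

/-- Over a field, `cross A ≠ 0` iff the rows of `A` are linearly independent. [folklore] -/
theorem cross_ne_zero_iff (A : Matrix (Fin d) (Fin (d + 1)) F) :
    cross A ≠ 0 ↔ LinearIndependent F (fun i => A i) :=
  ⟨linearIndependent_rows_of_cross_ne_zero A, cross_ne_zero_of_linearIndependent_rows A⟩

/-- `cross A` lies in the kernel of `A`. [folklore] -/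
theorem cross_mem_ker_mulVecLin (A : Matrix (Fin d) (Fin (d + 1)) F) :
    cross A ∈ LinearMap.ker A.mulVecLin := by
  rw [LinearMap.mem_ker, Matrix.mulVecLin_apply, mulVec_cross]

/-- If the rows of `A` are linearly independent, the kernel of `A` is the line spanned by
`cross A` (rank–nullity: the kernel has dimension `(d + 1) - d = 1` and contains `cross A ≠ 0`).
[folklore] -/
theorem ker_mulVecLin_eq_span_cross (A : Matrix (Fin d) (Fin (d + 1)) F)
    (h : LinearIndependent F (fun i => A i)) :
    LinearMap.ker A.mulVecLin = Submodule.span F {cross A} := by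
  have hne : cross A ≠ 0 := cross_ne_zero_of_linearIndependent_rows A h
  -- the kernel has dimension `1`
  have hrank : A.rank = d := by
    have := Matrix.rank_eq_finrank_span_row A
    rw [this, finrank_span_eq_card (b := fun i => A.row i) h, Fintype.card_fin]
  have hker : Module.finrank F (LinearMap.ker A.mulVecLin) = 1 := by
    have h1 := LinearMap.finrank_range_add_finrank_ker A.mulVecLin
    rw [Module.finrank_fin_fun] at h1
    have h2 : Module.finrank F (LinearMap.range A.mulVecLin) = d := by
      unfold Matrix.rank at hrank
      exact hrank
    omega
  -- a `1`-dimensional space containing the nonzero vector `cross A` is its span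
  apply le_antisymm
  · intro x hx
    have hmem : cross A ∈ LinearMap.ker A.mulVecLin := cross_mem_ker_mulVecLin A
    have hspan : Submodule.span F {(⟨cross A, hmem⟩ : LinearMap.ker A.mulVecLin)} = ⊤ := by
      apply Submodule.eq_top_of_finrank_eq
      rw [hker, finrank_span_singleton]
      exact fun h0 => hne (congrArg Subtype.val h0)
    have hx' : (⟨x, hx⟩ : LinearMap.ker A.mulVecLin) ∈
        Submodule.span F {(⟨cross A, hmem⟩ : LinearMap.ker A.mulVecLin)} := by
      rw [hspan]; exact Submodule.mem_top
    rw [Submodule.mem_span_singleton] at hx' ⊢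
    obtain ⟨c, hc⟩ := hx'
    exact ⟨c, by simpa using congrArg Subtype.val hc⟩
  · rw [Submodule.span_le, Set.singleton_subset_iff]
    exact cross_mem_ker_mulVecLin A

/-- Kernel vectors are multiples of the cross product (rows independent). [folklore] -/
theorem exists_smul_cross_of_mulVec_eq_zero (A : Matrix (Fin d) (Fin (d + 1)) F)
    (h : LinearIndependent F (fun i => A i)) {x : Fin (d + 1) → F} (hx : A *ᵥ x = 0) :
    ∃ c : F, c • cross A = x := by
  have hx' : x ∈ LinearMap.ker A.mulVecLin := by
    rw [LinearMap.mem_ker, Matrix.mulVecLin_apply, hx]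
  rw [ker_mulVecLin_eq_span_cross A h, Submodule.mem_span_singleton] at hx'
  exact hx'

end Field

end Literature.LinearAlgebra.Matrix
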